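import Summits.AtomisticToContinuum.Crystallization.Theorems.ThreeConeCertificateSlackRigidityPricedFloorsUnique2
import Summits.AtomisticToContinuum.Crystallization.Theorems.ThreeConeCertificateSlackRigidityPricedFloorsLayerEnergy
import HarnessLib

/-!
# `SlackRigidity` (stmt-AtomisticToContinuum-11960), line `priced-floors-palm-exactification`, stub S3
# (`stub_layeredMeanSelection`), package (U) "uniqueness of the layer system", part 3: the data
# relation, rigidity off the fcc lattice, fcc-likeness

Lead c19, worker W12.  The remaining registered sub-goals of the U-package:

* `lms_rel_of_fits` (U3) — the relation between two normal-form data fitting the same set: same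
  spacing; heights equal and words equal up to a global sign, or heights reversed (`m ↦ −z(−m)`) and
  words reversed (`m ↦ s(−m−1)`) up to a global sign.  By the trichotomy of part 2: equal layers ⇒
  (U2); reversed layers ⇒ (U2) for the REVERSED data `(−T, a, s(−·−1), −z(−·))`, which fit the same
  set (`SlackRigidityPricedFloorsLayerEnergy.reverse_fits`) and whose layers are the original ones
  under `m ↦ −m` (`layerOf_reverse`); both fcc ⇒ constant words and ideal heights, equal spacing;
* `lms_layerRigid_of_not_fcc` (U4) — off the ideal fcc lattice the layer system is rigid;
* `lms_isFccData_of_fccLike` (U5) — every presentation of an ideal fcc lattice is fcc-ideal.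

All `[folklore]`.
-/

noncomputable section

open Set
open scoped BigOperators

namespace Summit.AtomisticToContinuum.Crystallization.Theorems.SlackRigidityPricedFloorsUnique

open Literature.MathematicalPhysics.StatisticalMechanics
open Summit.AtomisticToContinuum.Crystallization.Theorems.SlackRigidityPricedFloors
open Summit.AtomisticToContinuum.Crystallization.Theorems.SlackRigidityPricedFloorsTransport

/-! ## Reversing the orientation -/

/-- Pattern points of the reversed data `(−T, a, s(−·−1), −z(−·))`: the point `(m, i, j)` is the point
`(−m, −i, −j)` of the original data. [folklore] -/
theorem pointOf_reverse (e : LData) (m i j : ℤ) :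
    pointOf ((-e.1, e.2.1, fun k => e.2.2.1 (-k - 1), fun k => -e.2.2.2 (-k)) : LData) m i j =
      pointOf e (-m) (-i) (-j) := by
  -- labels of the reversed word (`= …LayeredGluing07.haggLabel_reflect`, kept local to avoid the import)
  have haggLabel_reverse : ∀ (s : ℤ → ℤ) (m : ℤ),
      haggLabel (fun k => s (-k - 1)) m = -haggLabel s (-m) := by
    intro s m
    induction m using Int.induction_on with
    | zero => simp
    | succ n ih =>
      rw [haggLabel_succ, ih]
      have h := haggLabel_succ s (-((n : ℤ) + 1))
      rw [show -((n : ℤ) + 1) + 1 = -(n : ℤ) by ring] at h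
      rw [h]
      ring_nf
    | pred n ih =>
      have h1 := haggLabel_succ (fun k => s (-k - 1)) (-(n : ℤ) - 1)
      rw [show -(n : ℤ) - 1 + 1 = -(n : ℤ) by ring] at h1
      have h2 := haggLabel_succ s (n : ℤ)
      rw [show -(-(n : ℤ) - 1) = (n : ℤ) + 1 by ring]
      have : haggLabel (fun k => s (-k - 1)) (-(n : ℤ) - 1) =
          haggLabel (fun k => s (-k - 1)) (-(n : ℤ)) - s (-(-(n : ℤ) - 1) - 1) := by linarith
      rw [this, ih, h2, show -(-(n : ℤ) - 1) - 1 = (n : ℤ) by ring]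
      ring
  have hneg : ∀ x : E3, (-e.1) x = -(e.1 x) := fun x => rfl
  simp only [pointOf, haggLabel_reverse, hneg]
  rw [← map_neg]
  congr 1
  push_cast
  module

/-- **Layers of the reversed data** are the layers of the data under `m ↦ −m`. [folklore] -/
theorem layerOf_reverse (e : LData) (m : ℤ) :
    layerOf ((-e.1, e.2.1, fun k => e.2.2.1 (-k - 1), fun k => -e.2.2.2 (-k)) : LData) m =
      layerOf e (-m) := by
  ext p
  simp only [layerOf, mem_setOf_eq, pointOf_reverse]
  constructor
  · rintro ⟨i, j, rfl⟩; exact ⟨-i, -j, rfl⟩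
  · rintro ⟨i, j, rfl⟩; exact ⟨-i, -j, by rw [neg_neg, neg_neg]⟩

/-! ## (U3) The data relation -/

/-- **(U3) The data relation (registered sub-goal `lms_rel_of_fits`)**: two normal-form data fitting
the same set have the same spacing, and either the same heights and the same word up to a global
sign, or the reversed heights `m ↦ −z(−m)` and the reversed word `m ↦ s(−m−1)` up to a global sign
(for the ideal fcc lattice both presentations are of the first kind). [folklore] -/
theorem lms_rel_of_fits : ∀ (S : Set E3) (e e' : LData), Fits S e → Fits S e' → e'.2.1 = e.2.1 ∧ ((e'.2.2.2 = e.2.2.2 ∧ (e'.2.2.1 = e.2.2.1 ∨ e'.2.2.1 = fun m => -e.2.2.1 m)) ∨ (e'.2.2.2 = (fun m => -e.2.2.2 (-m)) ∧ (e'.2.2.1 = (fun m => e.2.2.1 (-m - 1)) ∨ e'.2.2.1 = fun m => -e.2.2.1 (-m - 1)))) := by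
  intro S e e' he he'
  -- a word without switches is constant
  have word_const : ∀ {s : ℤ → ℤ}, (∀ m : ℤ, s (m + 1) = s m) → ∀ m : ℤ, s m = s 0 := by
    intro s h m
    induction m using Int.induction_on with
    | zero => rfl
    | succ n ih => rw [h, ih]
    | pred n ih => rw [← ih, ← h, sub_add_cancel]
  -- heights with the same constant spacing and `z 0 = 0` coincide
  have heights_of_fcc : ∀ {z z' : ℤ → ℝ} {c : ℝ}, (∀ m : ℤ, z (m + 1) - z m = c) →
      (∀ m : ℤ, z' (m + 1) - z' m = c) → z 0 = 0 → z' 0 = 0 → z' = z := by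
    intro z z' c hz hz' h0 h0'
    funext m
    induction m using Int.induction_on with
    | zero => rw [h0, h0']
    | succ n ih => linarith [hz n, hz' n]
    | pred n ih =>
      have h1 := hz (-n - 1)
      have h2 := hz' (-n - 1)
      rw [sub_add_cancel] at h1 h2
      linarith
  rcases trichotomy he he' with h | h | ⟨h1, h2, ha⟩
  · obtain ⟨ha, hz, hs⟩ := lms_data_of_layers S e e' he he' h
    exact ⟨ha, Or.inl ⟨hz, hs⟩⟩
  · have her := SlackRigidityPricedFloorsLayerEnergy.reverse_fits he
    have hl : ∀ m : ℤ, layerOf e' m =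
        layerOf ((-e.1, e.2.1, fun k => e.2.2.1 (-k - 1), fun k => -e.2.2.2 (-k)) : LData) m :=
      fun m => by rw [h m, layerOf_reverse]
    obtain ⟨ha, hz, hs⟩ := lms_data_of_layers S _ e' her he' hl
    exact ⟨ha, Or.inr ⟨hz, hs⟩⟩
  · refine ⟨ha, Or.inl ⟨?_, ?_⟩⟩
    · refine heights_of_fcc h1.2 (fun m => ?_) he.1.2.2 he'.1.2.2
      rw [h2.2 m, ha]
    · have hc := word_const h1.1
      have hc' := word_const h2.1
      rcases he.1.2.1.2.2.1 0 with h0 | h0 <;> rcases he'.1.2.1.2.2.1 0 with h0' | h0'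
      · left; funext m; rw [hc, hc', h0, h0']
      · right; funext m; rw [hc, hc', h0, h0']
      · right; funext m; rw [hc, hc', h0, h0']; norm_num
      · left; funext m; rw [hc, hc', h0, h0']

/-! ## (U4), (U5) -/

/-- **(U4) Rigidity off the fcc lattice (registered sub-goal `lms_layerRigid_of_not_fcc`).** [folklore] -/
theorem lms_layerRigid_of_not_fcc : ∀ (S : Set E3), ¬ FccLike S → LayerRigid S := by
  intro S hS e e' he he'
  rcases lms_layer_dichotomy S e e' he he' with h | ⟨h1, -⟩
  · exact h
  · exact absurd ⟨e, he, h1⟩ hS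

/-- **(U5) Every presentation of an fcc lattice is fcc-ideal (registered sub-goal
`lms_isFccData_of_fccLike`).** [folklore] -/
theorem lms_isFccData_of_fccLike : ∀ (S : Set E3) (e : LData), FccLike S → Fits S e → IsFccData e := by
  rintro S e ⟨e₀, he₀, hf⟩ he
  obtain ⟨ha, h⟩ := lms_rel_of_fits S e₀ e he₀ he
  rcases h with ⟨hz, hs⟩ | ⟨hz, hs⟩
  · refine ⟨fun m => ?_, fun m => ?_⟩
    · rcases hs with hs | hs <;> simp [hs, hf.1 m]
    · rw [hz, ha]; exact hf.2 m
  · refine ⟨fun m => ?_, fun m => ?_⟩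
    · have h1 := hf.1 (-m - 1 - 1)
      rw [sub_add_cancel] at h1
      rcases hs with hs | hs <;> simp only [hs] <;>
        rw [show -(m + 1) - 1 = -m - 1 - 1 by ring, h1]
    · have h1 := hf.2 (-m - 1)
      rw [sub_add_cancel] at h1
      rw [hz, ha]
      simp only
      rw [show -(m + 1) = -m - 1 by ring]
      linarith

end Summit.AtomisticToContinuum.Crystallization.Theorems.SlackRigidityPricedFloorsUnique

end
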